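import Summits.AnomalousDissipation.AnomalousDissipation.Theses.TwoAndHalfD
import Literature.Analysis.FluidPDE.DoeringFoiasPowerProofs
import Literature.Analysis.FluidPDE.DoeringFoiasProofs
import Literature.Analysis.FluidPDE.ZerothLawProofs
import Literature.Analysis.FluidPDE.LongTimeAverageNonneg

/-!
# Negative knowledge for the crux `TwohalfdThesis` (stmt-AnomalousDissipation-0206), II: anatomy of a witness —
# necessary conditions at the Leray–Hopf level, and the bounded-enstrophy strengthening refuted

Certified copy of §3 of the cdisprove work file `Cruxes/TwohalfdThesis/Disproof.lean` (route `TwoAndHalfD`, target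
`X := TwohalfdThesis`).  `IsWitness f ν u₀ u E ε` bundles the data of `X` (`twohalfdThesis_iff_exists_isWitness`); everything
below is proved from tree theorems about ARBITRARY global Leray–Hopf solutions (no explicit flows):

* power floor `ε ≤ ⟨f, u_j⟩` at every level (`IsWitness.eps_le_meanPower`; Doering–Foias / Cheskidov–Doering–Petrov eq. (11),
  `DoeringFoias2002_dissipation_le_power_holds`) and power ceiling `⟨f,u_j⟩ ≤ ‖f‖₂√⟨‖u_j‖²⟩`
  (`IsWitness.meanPower_le`; `Torus.IsGlobalLerayHopf.meanPower_le`), whence `ε ≤ ‖f‖₂√E`, `E > 0`, `‖f‖₂ > 0`, `ε² ≤ ‖f‖₂²E`;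
* enstrophy floor `⟨‖∇u_j‖²⟩ ≥ ε/ν_j → ∞` (`IsWitness.enstrophy_ge`, `IsWitness.tendsto_meanEnstrophy_atTop`): the natural
  strengthening "`X` with `ν`-uniformly bounded mean enstrophy" is FALSE (`not_twohalfdThesisBoundedEnstrophy`) — witnesses
  are genuinely multi-scale (power enters at `|k| = O(1)`, gradients live at `|k| ~ ν^{-1/2}`);
* subsequences and tails of witness families are witness families (`IsWitness.comp_strictMono`, `IsWitness.exists_visc_le`).
(The energy floor `‖f‖₂² ≤ ‖∇f‖_∞·E` is `integral_norm_sq_le_mul_of_family` of the sibling file `PlanarForceOfDescent.lean`.)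
Supports stmt-AnomalousDissipation-0206.
-/

noncomputable section

namespace Summit.AnomalousDissipation.AnomalousDissipation.Theorems.TwohalfdThesis.Negative

open MeasureTheory Set Filter Topology UnitAddTorus
open scoped ENNReal NNReal InnerProductSpace
open Literature.Analysis.FunctionSpaces Literature.Analysis.FunctionSpaces.Torus
open Literature.Analysis.FluidPDE Literature.Analysis.FluidPDE.Torus
open Summit.AnomalousDissipation.AnomalousDissipation.Theses
open Summit.AnomalousDissipation.AnomalousDissipation.Theses.TwoAndHalfD

/-- Local notation: the flat unit three-torus. -/
local notation "𝕋³" => UnitAddTorus (Fin 3)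
/-- Local notation: velocity values. -/
local notation "E³" => EuclideanSpace ℝ (Fin 3)

/-! ## §3 Anatomy of a witness: necessary conditions at the Leray–Hopf level -/

section Anatomy

/-- **The data of an `X`-witness, bundled** (one fixed force `f`, viscosities `ν`, data `u₀`, solutions `u`,
energy ceiling `E`, dissipation floor `ε`), so that necessary conditions read `IsWitness … → …`. -/
structure IsWitness (f : 𝕋³ → E³) (ν : ℕ → ℝ) (u₀ : ℕ → 𝕋³ → E³) (u : ℕ → ℝ → 𝕋³ → E³) (E ε : ℝ) :
    Prop where
  /-- `f` is `x₃`-invariant. -/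
  force_inv : ∀ (s : UnitAddCircle) (x : 𝕋³), f (x + Pi.single (2 : Fin 3) s) = f x
  /-- `f ∈ C^∞`. -/
  smooth : IsSmooth f
  /-- `div f = 0`. -/
  divFree : IsDivFree f
  /-- `∫ f = 0`. -/
  zeroMean : HasZeroMean f
  /-- `ν_j > 0`. -/
  visc_pos : ∀ j, 0 < ν j
  /-- `ν_j → 0`. -/
  visc_tendsto : Tendsto ν atTop (𝓝 0)
  /-- each `u_j` is a global Leray–Hopf solution of NS_{ν_j} forced by `f`. -/
  lerayHopf : ∀ j, IsGlobalLerayHopf (ν j) (fun _ => f) (u₀ j) (u j)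
  /-- each `u_j` is `x₃`-invariant. -/
  sol_inv : ∀ j (t : ℝ) (s : UnitAddCircle) (x : 𝕋³), u j t (x + Pi.single (2 : Fin 3) s) = u j t x
  /-- the energy ceiling. -/
  energy_le : ∀ j, meanEnergy (u j) ≤ E
  /-- `ε > 0`. -/
  eps_pos : 0 < ε
  /-- the dissipation floor. -/
  eps_le : ∀ j, ε ≤ meanDissipation (ν j) (u j)

/-- `X` is the existence of a witness (definitional repackaging). [folklore] -/
theorem twohalfdThesis_iff_exists_isWitness :
    TwohalfdThesis ↔ ∃ f ν u₀ u E ε, IsWitness f ν u₀ u E ε := by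
  constructor
  · rintro ⟨f, hfinv, hs, hd, hz, ν, u₀, u, hν, hν0, hLH, huinv, ⟨E, hE⟩, ε, hε, hεj⟩
    exact ⟨f, ν, u₀, u, E, ε, ⟨hfinv, hs, hd, hz, hν, hν0, hLH, huinv, hE, hε, hεj⟩⟩
  · rintro ⟨f, ν, u₀, u, E, ε, h⟩
    exact ⟨f, h.force_inv, h.smooth, h.divFree, h.zeroMean, ν, u₀, u, h.visc_pos, h.visc_tendsto, h.lerayHopf,
      h.sol_inv, ⟨E, h.energy_le⟩, ε, h.eps_pos, h.eps_le⟩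

variable {f : 𝕋³ → E³} {ν : ℕ → ℝ} {u₀ : ℕ → 𝕋³ → E³} {u : ℕ → ℝ → 𝕋³ → E³} {E ε : ℝ}

/-- **Power floor.** At every level the fixed force injects mean power `⟨f, u_j⟩ ≥ ε`
(Doering–Foias / Cheskidov–Doering–Petrov eq. (11), in tree: `DoeringFoias2002_dissipation_le_power_holds`,
the Leray–Hopf energy inequality time-averaged).  Since `f̂` lives at `|k| = O(1)`, the LOW modes of `u_j` must
stay correlated with `f` uniformly in `j`. [cite: CheskidovDoeringPetrov2006, eq. (11)] -/
theorem IsWitness.eps_le_meanPower (h : IsWitness f ν u₀ u E ε) (j : ℕ) : ε ≤ meanPower f (u j) :=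
  (h.eps_le j).trans
    (DoeringFoias2002_dissipation_le_power_holds (h.visc_pos j) (h.smooth.memLp 2) h.zeroMean (u₀ j) (u j)
      (h.lerayHopf j))

/-- **Power ceiling** `⟨f, u_j⟩ ≤ ‖f‖₂ √⟨‖u_j‖²⟩` (Cauchy–Schwarz in space, Jensen in time; in tree:
`Torus.IsGlobalLerayHopf.meanPower_le`). [cite: CheskidovDoeringPetrov2006, eq. (17)] -/
theorem IsWitness.meanPower_le (h : IsWitness f ν u₀ u E ε) (j : ℕ) :
    meanPower f (u j) ≤ Real.sqrt (∫ x, ‖f x‖ ^ 2) * Real.sqrt (meanEnergy (u j)) := by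
  have := Torus.IsGlobalLerayHopf.meanPower_le (h.visc_pos j) h.smooth h.zeroMean (h.lerayHopf j)
  rwa [rmsVelocity_eq_sqrt_meanEnergy] at this

/-- **`ε ≤ ‖f‖₂ √E`**: the three budgets of `X` are coupled (Doering–Foias). [cite: DoeringFoias2002, §2] -/
theorem IsWitness.eps_le_norm_mul_sqrt (h : IsWitness f ν u₀ u E ε) :
    ε ≤ Real.sqrt (∫ x, ‖f x‖ ^ 2) * Real.sqrt E :=
  ((h.eps_le_meanPower 0).trans (h.meanPower_le 0)).trans
    (mul_le_mul_of_nonneg_left (Real.sqrt_le_sqrt (h.energy_le 0)) (Real.sqrt_nonneg _))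

/-- The witness force is nonzero in `L²`. [folklore] -/
theorem IsWitness.integral_norm_sq_force_pos (h : IsWitness f ν u₀ u E ε) : 0 < ∫ x, ‖f x‖ ^ 2 := by
  by_contra h0
  have h0' : ∫ x, ‖f x‖ ^ 2 = 0 := le_antisymm (not_lt.1 h0) (integral_nonneg fun _ => sq_nonneg _)
  have := h.eps_le_norm_mul_sqrt
  rw [h0', Real.sqrt_zero, zero_mul] at this
  exact absurd this (not_le.2 h.eps_pos)

/-- **The energy ceiling of a witness is positive** (indeed `E ≥ ε²/‖f‖₂²`). [folklore] -/
theorem IsWitness.energy_pos (h : IsWitness f ν u₀ u E ε) : 0 < E := by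
  by_contra hE
  have hE' : Real.sqrt E = 0 := Real.sqrt_eq_zero'.2 (not_lt.1 hE)
  have := h.eps_le_norm_mul_sqrt
  rw [hE', mul_zero] at this
  exact absurd this (not_le.2 h.eps_pos)

/-- **`ε² ≤ ‖f‖₂² · E`** (squared form of the Doering–Foias coupling). [cite: DoeringFoias2002, §2] -/
theorem IsWitness.eps_sq_le (h : IsWitness f ν u₀ u E ε) : ε ^ 2 ≤ (∫ x, ‖f x‖ ^ 2) * E := by
  have h1 := h.eps_le_norm_mul_sqrt
  have hf0 : 0 ≤ ∫ x, ‖f x‖ ^ 2 := integral_nonneg fun _ => sq_nonneg _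
  have h2 : ε ^ 2 ≤ (Real.sqrt (∫ x, ‖f x‖ ^ 2) * Real.sqrt E) ^ 2 :=
    pow_le_pow_left₀ h.eps_pos.le h1 2
  rwa [mul_pow, Real.sq_sqrt hf0, Real.sq_sqrt h.energy_pos.le] at h2

/-- The mean enstrophy `⟨‖∇u‖²⟩` (spectral, `toReal`, `limsup` of Cesàro means — same conventions as
`meanDissipation`). -/
def meanEnstrophy (v : ℝ → 𝕋³ → E³) : ℝ :=
  longTimeAvgSup fun t => (eGradNormSq (v t)).toReal

/-- `meanDissipation ν u = ν · meanEnstrophy u` for `ν ≥ 0` (nonnegative constants leave the `limsup`,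
`longTimeAvgSup_const_mul`, junk included). [folklore] -/
theorem meanDissipation_eq_mul_meanEnstrophy {ν' : ℝ} (hν : 0 ≤ ν') (v : ℝ → 𝕋³ → E³) :
    meanDissipation ν' v = ν' * meanEnstrophy v := by
  unfold meanDissipation meanEnstrophy
  exact longTimeAvgSup_const_mul hν _

/-- The mean enstrophy is nonnegative (junk included). [folklore] -/
theorem meanEnstrophy_nonneg (v : ℝ → 𝕋³ → E³) : 0 ≤ meanEnstrophy v :=
  longTimeAvgSup_nonneg fun _ => ENNReal.toReal_nonneg

/-- **Enstrophy floor**: `⟨‖∇u_j‖²⟩ ≥ ε/ν_j` at every level. [folklore] -/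
theorem IsWitness.enstrophy_ge (h : IsWitness f ν u₀ u E ε) (j : ℕ) : ε / ν j ≤ meanEnstrophy (u j) := by
  rw [div_le_iff₀ (h.visc_pos j), mul_comm, ← meanDissipation_eq_mul_meanEnstrophy (h.visc_pos j).le]
  exact h.eps_le j

/-- **The mean enstrophy of a witness family blows up**: `⟨‖∇u_j‖²⟩ → ∞` (witnesses are genuinely
multi-scale: power enters at `|k| = O(1)`, gradients live at `|k| ~ ν_j^{-1/2}`). [folklore] -/
theorem IsWitness.tendsto_meanEnstrophy_atTop (h : IsWitness f ν u₀ u E ε) :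
    Tendsto (fun j => meanEnstrophy (u j)) atTop atTop := by
  have hdiv : Tendsto (fun j => ε / ν j) atTop atTop := by
    have hinv : Tendsto (fun j => (ν j)⁻¹) atTop atTop :=
      (tendsto_inv_nhdsGT_zero (𝕜 := ℝ)).comp
        (tendsto_nhdsWithin_iff.2 ⟨h.visc_tendsto, Eventually.of_forall fun j => h.visc_pos j⟩)
    simpa [div_eq_mul_inv] using hinv.const_mul_atTop h.eps_pos
  exact tendsto_atTop_mono (fun j => h.enstrophy_ge j) hdiv

/-- `X` STRENGTHENED by a `ν`-uniform bound on the mean enstrophy, `∃ M, ∀ j, ⟨‖∇u_j‖²⟩ ≤ M`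
(everything else verbatim). -/
def TwohalfdThesisBoundedEnstrophy : Prop :=
  ∃ f : 𝕋³ → E³, (∀ (s : UnitAddCircle) (x : 𝕋³), f (x + Pi.single (2 : Fin 3) s) = f x) ∧
    IsSmooth f ∧ IsDivFree f ∧ HasZeroMean f ∧
    ∃ (ν : ℕ → ℝ) (u₀ : ℕ → 𝕋³ → E³) (u : ℕ → ℝ → 𝕋³ → E³),
      (∀ j, 0 < ν j) ∧ Tendsto ν atTop (𝓝 0) ∧
      (∀ j, IsGlobalLerayHopf (ν j) (fun _ => f) (u₀ j) (u j)) ∧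
      (∀ j (t : ℝ) (s : UnitAddCircle) (x : 𝕋³), u j t (x + Pi.single (2 : Fin 3) s) = u j t x) ∧
      (∃ E : ℝ, ∀ j, meanEnergy (u j) ≤ E) ∧
      (∃ M : ℝ, ∀ j, meanEnstrophy (u j) ≤ M) ∧
      ∃ ε : ℝ, 0 < ε ∧ ∀ j, ε ≤ meanDissipation (ν j) (u j)

/-- **The bounded-enstrophy strengthening of `X` is FALSE** (`ε ≤ ν_j ⟨‖∇u_j‖²⟩ ≤ ν_j M → 0`): no
`ν`-uniformly `H¹`-bounded family — in particular no family of `ν`-uniformly Lipschitz flows, no fixed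
finite-dimensional Galerkin class — can witness `X`. [folklore] -/
theorem not_twohalfdThesisBoundedEnstrophy : ¬ TwohalfdThesisBoundedEnstrophy := by
  rintro ⟨f, hfinv, hs, hd, hz, ν, u₀, u, hν, hν0, hLH, huinv, ⟨E, hE⟩, ⟨M, hM⟩, ε, hε, hεj⟩
  have hw : IsWitness f ν u₀ u E ε := ⟨hfinv, hs, hd, hz, hν, hν0, hLH, huinv, hE, hε, hεj⟩
  have ht := hw.tendsto_meanEnstrophy_atTop
  obtain ⟨j, hj⟩ := (ht.eventually_gt_atTop M).exists
  exact (not_lt.2 (hM j)) hj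

/-- **Any subsequence of a witness family is a witness family** (all clauses are level-wise or limits). [folklore] -/
theorem IsWitness.comp_strictMono (h : IsWitness f ν u₀ u E ε) {φ : ℕ → ℕ} (hφ : StrictMono φ) :
    IsWitness f (ν ∘ φ) (u₀ ∘ φ) (u ∘ φ) E ε :=
  ⟨h.force_inv, h.smooth, h.divFree, h.zeroMean, fun j => h.visc_pos (φ j), h.visc_tendsto.comp hφ.tendsto_atTop,
    fun j => h.lerayHopf (φ j), fun j => h.sol_inv (φ j), fun j => h.energy_le (φ j), h.eps_pos,
    fun j => h.eps_le (φ j)⟩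

/-- **WLOG `ν_j ≤ 1` (indeed `ν_j ≤` any `δ > 0`)**: pass to a tail. [folklore] -/
theorem IsWitness.exists_visc_le (h : IsWitness f ν u₀ u E ε) {δ : ℝ} (hδ : 0 < δ) :
    ∃ φ : ℕ → ℕ, StrictMono φ ∧ IsWitness f (ν ∘ φ) (u₀ ∘ φ) (u ∘ φ) E ε ∧ ∀ j, ν (φ j) ≤ δ := by
  obtain ⟨N, hN⟩ := eventually_atTop.1 (h.visc_tendsto.eventually (Iic_mem_nhds hδ))
  refine ⟨fun j => j + N, fun a b hab => Nat.add_lt_add_right hab N, h.comp_strictMono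
    (fun a b hab => Nat.add_lt_add_right hab N), fun j => hN _ (Nat.le_add_left N j)⟩

end Anatomy

end Summit.AnomalousDissipation.AnomalousDissipation.Theorems.TwohalfdThesis.Negative

end
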